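import Literature.IUT.HodgeArakelov.MonoThetaProjectiveBridgeEtTh
import Literature.IUT.HodgeArakelov.ModelDef11Output
import Literature.AnabelianGeometry.EtaleTheta.TemperedCoverings

/-!
# Bridge B8, part 5c: the NATURAL projective system of model mono-theta environments of `X̲̲_K` over `ℕ_{≥1}`,
# and [IUTchII] Prop. 1.5 (ii) at the genuine instance

abc-iut cell, MERGE-MAP §8 **B8** (layer L6 ↔ L2), continuation of part 5 (`MonoThetaProjectiveBridgeEtTh`, the model
family `EtaleLevels.modelFamily` and its reductions) and of part 6 (`ModelDef11Output`, abc-iut-L6-d6: the [IUTchII]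
Def. 1.1 output of the [EtTh] model); seat abc-iut-w4-d030; DAG nodes **IUTchII:Prop1.5(ii)** (and the non-vacuity
side of (i)). S. Mochizuki, *Inter-universal Teichmüller theory II*, kurims manuscript (Dec. 2020), Prop. 1.5 p. 29
[claim: Mochizuki2012, status: disputed] (IUTchII §1 Prop 1.5, kurims p.29); S. Mochizuki, *The étale theta function
…*, Publ. RIMS **45** (2009), Cor. 2.19 (ii) p. 290 (PRIMS PDF p. 64): "by letting the integer `N` vary in `E`, we obtain
a natural projective system … of model mono-theta environments" [cite: MochizukiEtTh2009, Cor 2.19(ii) p.64].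

* `EtaleLevels.modelSystem` — **the natural projective system** `… → 𝕄_{M'} → 𝕄_M → …` of the MODEL mono-theta
  environments of `X̲̲_K` for ALL `M ∈ ℕ_{≥1}`, as abc-iut-L6-t1's `MonoThetaProjSystem (EtaleLevels.modelFamily …)`:
  members `F.modelEnv M`, Def. 1.1 (i) outputs = abc-iut-L6-d6's `ModelFrame.reconstruction` of the [EtTh] model at each
  level (so `Π_X(𝕄_M) = Π^tp_{X̲̲}` for every `M`), transitions `red_{M',M}`, and the IDENTITY of `Π^tp_{X̲̲}` as the
  transition on `Π_X`. Inputs beyond part 5: abc-iut-L2-t1's named fact `Prop15iii` and cusp labels (inputs of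
  L2-t8's `rigidData`) and "`(l·Δ_Θ)/thetaKer ≅ Ẑ` as an abstract group" (`hZ`, [EtTh] §1 p. 12, part 6's residual).
* `EtaleLevels.isMonoThetaCompatible_modelSystem` — NON-VACUITY of the repaired hypothesis of Prop. 1.5 (i)′: the
  natural system IS a projective system of mono-theta environments for the model reductions (`IsMonoThetaCompatible`,
  abc-iut-L6-t19), UNCONDITIONALLY.
* `EtaleLevels.transitionsAreIsos_modelSystem` — **[IUTchII] Prop. 1.5 (ii) at the genuine instance** (abc-iut-L6-t1's
  `MonoThetaProjSystem.transitionsAreIsos`: the transitions on `Π_X(M^Θ_M)` are isomorphisms — here identities — and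
  "any isomorphism of topological groups `Π_X(M^Θ_{M'}) ⥲ Π_X(M^Θ_M)` … lifts to a morphism of mono-theta environments
  [cf. [EtTh], Corollary 2.18, (iv)]"), PROVED for `modelSystem` modulo, BY NAME: the level-wise [EtTh] Cor. 2.18 (iv)
  named fact `ThetaEnvData.Cor218_iv_surjective` (lifting of automorphisms of `Π^tp_{X̲̲}` preserving `Π^tp_{Y̲̲}` to the
  model) and the topological characteristicity of `Π^tp_{Y̲̲} ⊆ Π^tp_{X̲̲}` (`IsTopCharacteristic`, abc-iut-L2-t2's
  [EtTh] Def. 3.3 (i) notion; = the content of [EtTh] Prop. 2.4 used by print, cf. abc-iut-w4-d034's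
  `isTopCharacteristic_PiYtp_subgroupOf_of_prop24`) — the typed clause quantifies over ALL topological automorphisms of
  `Π_X`, so this input is exactly what it needs beyond Cor. 2.18 (iv).
HONEST FRAMING: constructions/bookkeeping over the cell's own [EtTh]-side objects; nothing disputed is asserted (the
[IUTchII] side is the claim key `Mochizuki2012`, DISPUTED); no side is taken on [IUTchIII] Cor. 3.12; typed ≠ discharged.
-/

noncomputable section

namespace Literature.IUT.HodgeArakelov

open Literature.AnabelianGeometry.EtaleTheta Literature.AnabelianGeometry.SemiGraphs
open scoped Literature.AnabelianGeometry.EtaleTheta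

namespace EtaleLevels

variable {p : ℕ} [Fact p.Prime] {D : Literature.AnabelianGeometry.EtaleTheta.ThetaSetting p}
  {E : D.EtaleThetaData} {l : ℕ} (C : E.DoubleUnderline l) (hC : D.Compat) (hS : D.Sec2Hyps)
  (hl : l.Prime) (hp2 : p ≠ 2) (hpl : p ≠ l) (hζ : ∃ ζ : D.K, IsPrimitiveRoot ζ (4 * l))
  (mods : ∀ M : ℕ+, D.CyclotomeMod l M)
  (f : contCocycles D.toTheta D.DeltaTheta C.GtpYdduu) (hf : f ∈ C.rootCocycles hC)
  (hmods : ∀ (M M' : ℕ+) (h : (M : ℕ) ∣ (M' : ℕ)) (x : D.lDeltaTheta l),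
    MuN.red p M M' h ((mods M').red x) = (mods M).red x)
  (h15 : Literature.AnabelianGeometry.EtaleTheta.ThetaSetting.Prop15iii E hC) (L : C.CuspLabels)
  (hZ : ∀ M : ℕ+, Nonempty (ModelCyclotomes.lDeltaQuot (C.rigidData (mods M) hC hS h15 L) ≃*
    Literature.IUT.HodgeTheaters.ZHat))

/-! ## The [IUTchII] Def. 1.1 (i) output of the model at level `M` (parts 5b/6) -/

/-- The side data of the [IUTchII] §1 setting at level `M` (part 3), with `η⁰_M` singled out.
[claim: Mochizuki2012, status: disputed] (IUTchII §1, kurims p.20) -/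
def sideData (M : ℕ+) : ThetaSetting.SideData (C.thetaEnvData (mods M) hC hS) :=
  ThetaSetting.SideData.ofDoubleUnderline C (mods M) hC hS hl hp2 hpl hζ (eta0_mem C hC hS mods f hf M)

/-- abc-iut-L6-d6's `ModelFrame` of the [EtTh] model at level `M` (frame = identity; `Π^tp_{X̲̲}` T₁ and `Δ` closed are
part 6's theorems; `(l·Δ_Θ)/thetaKer ≅ Ẑ` is the hypothesis `hZ`). [claim: Mochizuki2012, status: disputed] (IUTchII §1 Def 1.1 (i), kurims pp.20-21) -/
def modelFrame (M : ℕ+) :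
    ModelFrame (levelSetting C hC hS hl hp2 hpl hζ mods f hf M) (C.rigidData (mods M) hC hS h15 L) :=
  ThetaSetting.modelFrameOfThetaEnvData (C.rigidData (mods M) hC hS h15 L) (sideData C hC hS hl hp2 hpl hζ mods f hf M)
    (ThetaSetting.t1Space_Huu C) (ThetaSetting.isClosed_ker_aug_thetaEnvData C (mods M) hC hS) (hZ M)

/-- **The [IUTchII] Def. 1.1 (i) output of the MODEL mono-theta environment at level `M`** (abc-iut-L6-d6's
`ModelFrame.reconstruction` at the identity): `Π_Y(𝕄_M) = Π^tp_{Y̲̲}`, `Π_X(𝕄_M) = Π^tp_{X̲̲}`, `G(𝕄_M) = Π^tp_{X̲̲}/Δ`, the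
interior/exterior cyclotomes of part 5b. [claim: Mochizuki2012, status: disputed] (IUTchII §1 Def 1.1 (i), kurims pp.20-21) -/
def modelRecon (M : ℕ+) : Reconstruction ((modelFamily C hC hS hl hp2 hpl hζ mods f hf).modelEnv M) :=
  (modelFrame C hC hS hl hp2 hpl hζ mods f hf h15 L hZ M).reconstruction (ContinuousMulEquiv.refl _)

/-- `Π_X(𝕄_M) = Π^tp_{X̲̲}` (bookkeeping, on the nose). [claim: Mochizuki2012, status: disputed] (IUTchII §1 Def 1.1 (i), kurims p.21) -/
theorem modelRecon_PiX (M : ℕ+) :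
    (modelRecon C hC hS hl hp2 hpl hζ mods f hf h15 L hZ M).PiX = TopGroup.of ↥C.Huu :=
  rfl

/-! ## The natural projective system of model mono-theta environments -/

/-- **The natural projective system `… → 𝕄_{M'} → 𝕄_M → …` of the MODEL mono-theta environments of `X̲̲_K` over
ALL `M ∈ ℕ_{≥1}`** ([EtTh] Cor. 2.19 (ii) "natural projective system … of model mono-theta environments", here over the
full index set of [IUTchII] Prop. 1.5), as abc-iut-L6-t1's `MonoThetaProjSystem`: transitions `red_{M',M}` and the
identity of `Π^tp_{X̲̲}` on `Π_X`. [claim: Mochizuki2012, status: disputed] (IUTchII §1 Prop 1.5, kurims p.29) -/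
def modelSystem : MonoThetaProjSystem (modelFamily C hC hS hl hp2 hpl hζ mods f hf) where
  env M := (modelFamily C hC hS hl hp2 hpl hζ mods f hf).modelEnv M
  recon M := modelRecon C hC hS hl hp2 hpl hζ mods f hf h15 L hZ M
  trans h := red C hC hS mods h
  trans_continuous h := continuous_red C hC hS mods hmods h
  trans_refl M x := red_refl C hC hS mods M x
  trans_comp h h' x := red_comp C hC hS mods h h' x
  transX _ := MonoidHom.id ↥C.Huu
  transX_continuous _ := continuous_id
  transX_compat _ _ := rfl

/-- The members of the natural system ARE the models (bookkeeping). [claim: Mochizuki2012, status: disputed] (IUTchII §1 Prop 1.5, kurims p.29) -/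
theorem modelSystem_env (M : ℕ+) :
    (modelSystem C hC hS hl hp2 hpl hζ mods f hf hmods h15 L hZ).env M =
      (modelFamily C hC hS hl hp2 hpl hζ mods f hf).modelEnv M :=
  rfl

/-- The transitions of the natural system ARE the model reductions (bookkeeping).
[claim: Mochizuki2012, status: disputed] (IUTchII §1 Prop 1.5, kurims p.29) -/
theorem modelSystem_trans {M M' : ℕ+} (h : (M : ℕ) ∣ (M' : ℕ)) (x : (levelData C hC hS mods M').env) :
    (modelSystem C hC hS hl hp2 hpl hζ mods f hf hmods h15 L hZ).trans h x = red C hC hS mods h x :=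
  rfl

/-! ## Non-vacuity of Prop. 1.5 (i)′ and [IUTchII] Prop. 1.5 (ii) at the genuine instance -/

/-- **NON-VACUITY of the repaired hypothesis of Prop. 1.5 (i)′**: the natural system is a projective system OF
MONO-THETA ENVIRONMENTS for the model reductions (abc-iut-L6-t19's `IsMonoThetaCompatible`) — each transition IS
`red_{M',M}`, witnessed by identity isomorphisms. UNCONDITIONAL (given the construction's inputs).
[claim: Mochizuki2012, status: disputed] (IUTchII §1 Prop 1.5 (i), kurims p.29) -/
theorem isMonoThetaCompatible_modelSystem
    (hslimX : Literature.AlgebraicGeometry.Frobenioids.IsSlimGroup D.PiTemp) :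
    (modelSystem C hC hS hl hp2 hpl hζ mods f hf hmods h15 L hZ).IsMonoThetaCompatible
      (reductions C hC hS hl hp2 hpl hζ mods f hf hmods hslimX) :=
  fun _ _ _ => ⟨MonoThetaEnv.Iso.refl _, MonoThetaEnv.Iso.refl _, fun _ => rfl⟩

/-- **[IUTchII] Prop. 1.5 (ii) FOR THE NATURAL SYSTEM of `X̲̲_K`** (abc-iut-L6-t1's
`MonoThetaProjSystem.transitionsAreIsos`, p. 29: "The transition morphisms of the resulting projective system of
topological groups `{… → Π_X(M^Θ_{M'}) → Π_X(M^Θ_M) → …}` are all isomorphisms. Moreover, any isomorphism of topological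
groups `Π_X(M^Θ_{M'}) ⥲ Π_X(M^Θ_M)`, where `M` divides `M'`, lifts to a morphism of mono-theta environments
`M^Θ_{M'} → M^Θ_M` [cf. [EtTh], Corollary 2.18, (iv)]"): here the transitions on `Π_X = Π^tp_{X̲̲}` are identities, and a
topological automorphism `e` of `Π^tp_{X̲̲}` preserves `Π^tp_{Y̲̲}` (`hchar`), hence lifts to the mod-`M'` model by the
level fact `Cor218_iv_surjective` (`hsurj`), and composing with `red_{M',M}` gives the required continuous surjection
`Π^tp_{Y̲̲}[μ_{M'}] ↠ Π^tp_{Y̲̲}[μ_M]` inducing `e` on `Π^tp_{Y̲̲}`. [claim: Mochizuki2012, status: disputed] (IUTchII §1 Prop 1.5 (ii), kurims p.29) -/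
theorem transitionsAreIsos_modelSystem
    (hchar : Literature.AnabelianGeometry.EtaleTheta.IsTopCharacteristic ↥C.Huu (D.GtpY.subgroupOf C.Huu))
    (hsurj : ∀ M : ℕ+, (levelData C hC hS mods M).Cor218_iv_surjective) :
    (modelSystem C hC hS hl hp2 hpl hζ mods f hf hmods h15 L hZ).transitionsAreIsos := by
  refine ⟨fun h => ⟨Function.bijective_id, IsOpenMap.id⟩, fun {M M'} h e => ?_⟩
  -- `e` preserves `Π^tp_{Y̲̲}`
  have hPiY : (levelData C hC hS mods M').PiY.map e.toMulEquiv.toMonoidHom = (levelData C hC hS mods M').PiY :=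
    hchar e
  -- lift `e` to the mod-`M'` model ([EtTh] Cor. 2.18 (iv), first half)
  obtain ⟨α, hα⟩ := hsurj M' (eta0 C hC mods f hf M') (eta0_mem C hC hS mods f hf M') e hPiY
  refine ⟨(red C hC hS mods h).comp α.e.toMulEquiv.toMonoidHom,
    (continuous_red C hC hS mods hmods h).comp α.e.continuous,
    (red_surjective C hC hS mods hmods h).comp α.e.surjective, fun x => ?_⟩
  exact (hα x).symm

end EtaleLevels

end Literature.IUT.HodgeArakelov
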